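import Literature.AlgebraicGeometry.Motives.UniversalHypersurfaceRegularLocusChartCoeff
import HarnessLib

/-!
# The solved coefficient solves the equation: `F_{b(b', y)}(y with xᵢ = 1) = 0`

Family `hodge`, layer `Literature/AlgebraicGeometry/Motives`; complement to `UniversalHypersurfaceRegularLocusChartCoeff`. The coefficient vector
`regChartCoeffVec n d i (b', y)` is DEFINED by solving the hypersurface equation for the coefficient of `xᵢ^d` at the affine point `y` (chart
`xᵢ = 1`); this file records the resulting identity `F_{regChartCoeffVec (b', y)}(insertNth i 1 y) = 0` for ALL `(b', y)` — the hypothesis `hw` of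
`UniversalHypersurfaceRegularLocusSubmersion.exists_regChartFun_eq`, needed to produce points of `𝒴°(ℂ)ᵢ` with PRESCRIBED chart coordinates (the
model isotopy of the degeneration programme is defined by moving the affine coordinates and keeping `b'`).

* `eval_formOfCoeffs_regChartCoeffVec` — the identity.

Everything is proved; no definitions, no named facts.

## References

* [VoisinHodgeII2003] C. Voisin, Hodge Theory and Complex Algebraic Geometry II (2003), §6.2.1.
* [BrockerJanichIDT1982] T. Bröcker, K. Jänich, Introduction to Differential Topology (1982), §5.
-/

noncomputable section

open MvPolynomial Set Function

namespace Literature.AlgebraicGeometry.Motives.UniversalHypersurface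

variable (n d : ℕ) (i : Fin (n + 2))

/-- **The solved coefficient solves the equation**: `F_{regChartCoeffVec (b', y)}(insertNth i 1 y) = 0`.
[cite: VoisinHodgeII2003, §6.2.1] [cite: BrockerJanichIDT1982, §5] -/
theorem eval_formOfCoeffs_regChartCoeffVec (v : ({m : DegIndex n d // m ≠ regPowIndex n d i} ⊕ Fin (n + 1)) → ℂ) :
    MvPolynomial.eval (Fin.insertNth i (1 : ℂ) (fun j => v (Sum.inr j)) : Fin (n + 2) → ℂ)
      (formOfCoeffs (regChartCoeffVec n d i v)) = 0 := by
  classical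
  set w : Fin (n + 2) → ℂ := Fin.insertNth i (1 : ℂ) (fun j => v (Sum.inr j)) with hw
  have hwi : w i = 1 := by rw [hw]; exact Fin.insertNth_apply_same (α := fun _ : Fin (n + 2) => ℂ) i (1 : ℂ) _
  rw [eval_formOfCoeffs, Fintype.sum_eq_add_sum_subtype_ne _ (regPowIndex n d i), prod_regPowIndex, hwi, one_pow, mul_one,
    regChartCoeffVec_regPowIndex]
  have hterms : (∑ m' : {m : DegIndex n d // m ≠ regPowIndex n d i},
      regChartCoeffVec n d i v m'.1 * m'.1.1.prod fun k e => w k ^ e) =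
      ∑ m' : {m : DegIndex n d // m ≠ regPowIndex n d i}, v (Sum.inl m') * m'.1.1.prod fun k e => w k ^ e := by
    refine Finset.sum_congr rfl fun m' _ => ?_
    rw [regChartCoeffVec_of_ne n d i v m'.2]
  rw [hterms, hw]
  ring

end Literature.AlgebraicGeometry.Motives.UniversalHypersurface

end
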